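import Literature.AlgebraicGeometry.HodgeTheory.ChernCharacterTautologicalPullback
import Literature.Geometry.Kaehler.ComplexTorusMaps
import Literature.Geometry.Kaehler.ComplexTorusHodgeDecomposition
import HarnessLib

/-!
# The rigidity scalar of two natural de Rham comparisons is invariant under diffeomorphisms;
# one scalar for all complex tori with the same model and the same comparison family

Family `hodge`, layer `Literature/AlgebraicGeometry/HodgeTheory`, namespace
`Literature.AlgebraicGeometry.HodgeTheory` (cell hodgecm-mathlib, seat B-p13 (g16), piece (K1) of the
N3-core assembler of the U-e P4 node, B-p03 (g14) 2026-08-29).  THEOREMS ONLY: no definition, no named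
fact, no instance, no notation.

## The mathematics

Let `E` be a finite-dimensional complex model space and let `e`, `e″` be two complex de Rham
comparison families over the manifolds charted on `E`, both NATURAL for `C^∞` maps
(`ComplexDeRhamIsoFamily.IsNatural`: `e_M (f^*_dR c) = f^* (e_N c)`).  Suppose that on some manifold
`M` the two comparisons differ by a scalar in degree `k`, `e_M = r • e″_M` on `Hᵏ_dR(M; ℂ)` (for a
compact `M` such an `r` always exists by the rigidity of natural comparisons, the tree's
`NaturalDeRhamComparisonRigidity_holds`, packaged as `HodgeModel.exists_ne_zero_deRham_eq_smul_inducedIso`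
for `e = A.deRham` and `e″` the comparison induced from a second Hodge model `B` through the cylinder,
`HodgeModel.inducedIso`).  **Then the SAME scalar works on every manifold `M′` diffeomorphic to `M`**:
for a homeomorphism `h : M ≃ₜ M′` which is `C^∞` and `c ∈ Hᵏ_dR(M′; ℂ)`,
`h^*(e_{M′} c) = e_M(h^*_dR c) = r • e″_M(h^*_dR c) = h^*(r • e″_{M′} c)` by naturality of both families
along `h`, and `h^*` is injective on singular cohomology (`singularCohomology.mapIso`).  Neither
compactness nor the rigidity theorem is used: this is Bott–Tu's functoriality of the de Rham
isomorphism [BottTu1982Forms, §I.5] read twice, together with Voisin's functoriality of `φ^*`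
[VoisinHodgeI2002, §7.3.2].

Application (the design constraint of the N3-core assembler: «every `∃ scalar ≠ 0` must be quantified
BEFORE the fibre datum»).  All complex tori `ComplexTorus Φ = E/Φ(ℤ^ι)` with the same model `E` and
the same index type `ι` are diffeomorphic — as types they are all the real torus `ι → ℝ/ℤ`, and the
identity `ρ(1) = ComplexTorus.mapMatrix Φ Φ′ 1` is real `C^∞` in both directions
[LangeBirkenhake1992, §1.1.2] (`complexTorus_exists_diffeomorph`).  Hence for the TORUS HODGE MODELS
`⟨E, ComplexTorus Φ, φ, hφ, e₀, …⟩` of torus-analytified smooth projective varieties (one fixed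
comparison family `e₀` over `E`, e.g. the family of record `(integrationDeRhamIsoFamily E).complexify`)
and one fixed Hodge model `B` of a variety of dimension `m ≥ n` (in the application `ℙᴷ`), the
rigidity scalar `r` of `exists_ne_zero_deRham_eq_smul_inducedIso` can be chosen ONCE for all `(X, Φ, φ)`:
`exists_ne_zero_forall_torusModel_deRham_eq_smul_inducedIso`.  The assembler then feeds this uniform `r`
into the explicit-scalar comparison `HodgeModel.chernCharacter_pullback_eq_smul_map_of_deRham_eq_smul`
fibre by fibre.  (The induced comparison `inducedIso B A hnm` depends on the torus model `A` only
through its model space `E` and the PROPOSITION `dim_ℂ E = n`, so it is the same map for all torus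
models over `E` — definitionally, by proof irrelevance; `inducedIso_torusModel_eq`.)

## Results

* `deRhamFamily_eq_smul_transport` — the transport lemma for two natural families over one model.
* `HodgeModel.deRham_eq_smul_inducedIso_transport` — the same for `A.deRham` versus the comparison
  induced from a second Hodge model `B`, from `A.carrier` to any `A.model`-manifold diffeomorphic to it.
* `complexTorus_exists_diffeomorph` — `ComplexTorus Φ ≃ₜ ComplexTorus Φ′`, the identity on `ι → ℝ/ℤ`,
  `C^∞` with `C^∞` inverse (packaged as `∃`, no new definition).
* `inducedIso_torusModel_eq`, `torusModel_deRham_eq_smul_inducedIso_transport`,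
  **`exists_ne_zero_forall_torusModel_deRham_eq_smul_inducedIso`** — ONE non-zero scalar for all torus
  models over `(E, e₀)`.

## References

* [BottTu1982Forms] R. Bott, L. W. Tu, *Differential Forms in Algebraic Topology*, GTM 82 (1982), §I.5
  (functoriality of the de Rham isomorphism).
* [VoisinHodgeI2002] C. Voisin, *Hodge Theory and Complex Algebraic Geometry I* (CUP 2002), §7.3.2.
* [LangeBirkenhake1992] H. Lange, Ch. Birkenhake, *Complex Abelian Varieties* (1992), §1.1.2
  (analytic and rational representations of homomorphisms of complex tori).
-/

noncomputable section

open scoped Manifold ContDiff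
open CategoryTheory
open Literature.NumberTheory.Transcendental (IsAnalytification complexDeRhamCohomology ComplexDeRhamIsoFamily
  PullbackFacts)
open Literature.AlgebraicTopology.SingularHomology (singularCohomology)
open Literature.Geometry.Kaehler (ComplexTorus)

universe u

namespace Literature.AlgebraicGeometry.HodgeTheory

/-! ### §1 Transport of a scalar relation between two natural families along a diffeomorphism -/

section Transport

variable {E : Type u} [NormedAddCommGroup E] [NormedSpace ℂ E]
  {e e' : ComplexDeRhamIsoFamily E}
  {M M' : Type u} [TopologicalSpace M] [ChartedSpace E M] [IsManifold 𝓘(ℝ, E) ∞ M] [T2Space M]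
  [SigmaCompactSpace M] [TopologicalSpace M'] [ChartedSpace E M'] [IsManifold 𝓘(ℝ, E) ∞ M']
  [T2Space M'] [SigmaCompactSpace M'] [PullbackFacts 𝓘(ℝ, E) M 𝓘(ℝ, E) M' ℂ]

/-- **The scalar relating two natural de Rham comparison families is a diffeomorphism invariant.**
Let `e`, `e′` be natural complex de Rham comparison families over the manifolds charted on `E`, and
suppose `e_M = r • e′_M` on `Hᵏ_dR(M; ℂ)`.  If `h : M ≃ₜ M′` is a homeomorphism which is `C^∞`, then
`e_{M′} = r • e′_{M′}` on `Hᵏ_dR(M′; ℂ)`: by naturality of both families along `h`,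
`h^*(e_{M′} c) = e_M(h^*_dR c) = r • e′_M(h^*_dR c) = h^*(r • e′_{M′} c)`, and `h^*` is injective
(`singularCohomology.mapIso`).  No compactness and no rigidity theorem is needed.
[cite: BottTu1982Forms, §I.5] [cite: VoisinHodgeI2002, §7.3.2] -/
theorem deRhamFamily_eq_smul_transport (he : e.IsNatural) (he' : e'.IsNatural) (h : M ≃ₜ M')
    (hh : ContMDiff 𝓘(ℝ, E) 𝓘(ℝ, E) ∞ h) (k : ℕ) {r : ℂ}
    (hr : ∀ y : complexDeRhamCohomology E M k, e M k y = r • e' M k y) :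
    ∀ y' : complexDeRhamCohomology E M' k, e M' k y' = r • e' M' k y' := by
  intro y'
  have h1 := he M M' h hh k y'
  have h2 := he' M M' h hh k y'
  apply (singularCohomology.mapIso ℂ ℂ h k).toLinearEquiv.injective
  rw [map_smul]
  simp only [Iso.toLinearEquiv_apply, singularCohomology.mapIso_hom]
  have hcoe : (h : C(M, M')) = ⟨h, hh.continuous⟩ := rfl
  rw [hcoe, ← h1, ← h2]
  exact hr _

end Transport

/-! ### §2 Hodge models: `A.deRham` versus the comparison induced from a second model `B` -/

section HodgeModels

variable {n m : ℕ} {T Y : Motives.SchemeOver ℂ}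

/-- **The rigidity scalar of `HodgeModel.exists_ne_zero_deRham_eq_smul_inducedIso` is invariant under
diffeomorphisms of the carrier.**  For Hodge models `A` of `T` (dimension `n`) and `B` of `Y`
(dimension `m ≥ n`): if `A.deRham = r • e″` on `Hᵏ_dR(T^an; ℂ)` with `e″ = inducedIso B A hnm` the
comparison over `A.model`-manifolds induced from `B.deRham`, then for EVERY manifold `M′` charted on
`A.model` and diffeomorphic to `T^an` through a `C^∞` homeomorphism `h : T^an ≃ₜ M′` one has
`A.deRham_{M′} = r • e″_{M′}` on `Hᵏ_dR(M′; ℂ)` — both families are natural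
(`HodgeModel.deRham_isNatural`, `HodgeModel.isNatural_inducedFamily`).
[cite: BottTu1982Forms, §I.5] [cite: VoisinHodgeI2002, §7.3.2] -/
theorem HodgeModel.deRham_eq_smul_inducedIso_transport (A : HodgeModel n T) (B : HodgeModel m Y)
    (hnm : n ≤ m) {M' : Type} [TopologicalSpace M'] [ChartedSpace A.model M']
    [IsManifold 𝓘(ℝ, A.model) ∞ M'] [T2Space M'] [SigmaCompactSpace M'] (h : A.carrier ≃ₜ M')
    (hh : ContMDiff 𝓘(ℝ, A.model) 𝓘(ℝ, A.model) ∞ h) (k : ℕ) {r : ℂ}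
    (hr : ∀ y : complexDeRhamCohomology A.model A.carrier k,
      A.deRham A.carrier k y = r • HodgeModel.inducedIso B A hnm A.carrier k y) :
    ∀ y' : complexDeRhamCohomology A.model M' k,
      A.deRham M' k y' = r • HodgeModel.inducedIso B A hnm M' k y' :=
  deRhamFamily_eq_smul_transport (e' := HodgeModel.inducedFamily B A hnm) A.deRham_isNatural
    (HodgeModel.isNatural_inducedFamily B A hnm) h hh k hr

end HodgeModels

/-! ### §3 Complex tori with the same model are diffeomorphic; one scalar for all torus models -/

section Tori

open Literature.Geometry.Kaehler.ComplexTorus (mapMatrix contMDiff_real_mapMatrix)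

variable {ι : Type u} [Fintype ι] [DecidableEq ι] {E : Type u} [NormedAddCommGroup E] [NormedSpace ℂ E]

/-- `ρ(1)` is the identity on the points of `(ℝ/ℤ)^ι` (local copy of `ComplexTorus.mapMatrix_one_eq`,
whose home `ComplexTorusProductL2` is not imported here). [cite: LangeBirkenhake1992, §1.1.2] -/
private theorem mapMatrix_one_eq' (Φ Φ' : (ι → ℝ) ≃L[ℝ] E) (x : ComplexTorus Φ) :
    mapMatrix Φ Φ' (1 : Matrix ι ι ℤ) x = x := by
  funext i
  change ∑ j, (1 : Matrix ι ι ℤ) i j • x j = x i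
  rw [Finset.sum_eq_single i (fun j _ hj ↦ by rw [Matrix.one_apply_ne' hj, zero_smul])
    (fun hi ↦ absurd (Finset.mem_univ i) hi), Matrix.one_apply_eq, one_smul]

/-- **All complex tori `E/Φ(ℤ^ι)` with the same model `E` and index type `ι` are diffeomorphic**: the
identity of the real torus `(ℝ/ℤ)^ι` — the homomorphism `ρ(1) = mapMatrix Φ Φ′ 1` — is a homeomorphism
`ComplexTorus Φ ≃ₜ ComplexTorus Φ′` which is real `C^∞` with real `C^∞` inverse (its analytic
representation is the real-linear `Φ′ ∘ Φ⁻¹`).  Packaged as an existence statement (no definition).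
[cite: LangeBirkenhake1992, §1.1.2] -/
theorem complexTorus_exists_diffeomorph (Φ Φ' : (ι → ℝ) ≃L[ℝ] E) :
    ∃ h : ComplexTorus Φ ≃ₜ ComplexTorus Φ',
      (∀ x, (h x : ι → AddCircle (1 : ℝ)) = x) ∧ ContMDiff 𝓘(ℝ, E) 𝓘(ℝ, E) ∞ h ∧
        ContMDiff 𝓘(ℝ, E) 𝓘(ℝ, E) ∞ h.symm := by
  refine ⟨{ toFun := mapMatrix Φ Φ' (1 : Matrix ι ι ℤ)
            invFun := mapMatrix Φ' Φ (1 : Matrix ι ι ℤ)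
            left_inv := fun x ↦ by rw [mapMatrix_one_eq', mapMatrix_one_eq']
            right_inv := fun x ↦ by rw [mapMatrix_one_eq', mapMatrix_one_eq']
            continuous_toFun := (contMDiff_real_mapMatrix (n := 0) (1 : Matrix ι ι ℤ)).continuous
            continuous_invFun := (contMDiff_real_mapMatrix (n := 0) (1 : Matrix ι ι ℤ)).continuous },
    fun x ↦ mapMatrix_one_eq' Φ Φ' x, contMDiff_real_mapMatrix (1 : Matrix ι ι ℤ),
    contMDiff_real_mapMatrix (1 : Matrix ι ι ℤ)⟩

end Tori

section TorusModels

variable {ι : Type} [Fintype ι] [DecidableEq ι] {E : Type} [NormedAddCommGroup E] [NormedSpace ℂ E]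
  [FiniteDimensional ℂ E] {n m : ℕ} {Y : Motives.SchemeOver ℂ}

omit [DecidableEq ι] in
/-- **The comparison induced from `B` is the same map for all torus models over `E`.**  For two
torus Hodge models `⟨E, ComplexTorus Φ, φ, hφ, e₀, …⟩` (of `X`) and `⟨E, ComplexTorus Φ′, φ′, hφ′, e₀′, …⟩`
(of `X′`), the comparison families over `E`-manifolds induced from a Hodge model `B` through the
cylinder coincide on every `E`-manifold `M`: the construction `HodgeModel.inducedIso` sees the small
model only through its model space `E` and the proposition `dim_ℂ E = n` (definitional, by proof
irrelevance). [cite: BottTu1982Forms, §I.5] -/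
theorem inducedIso_torusModel_eq (B : HodgeModel m Y) (hnm : n ≤ m)
    {X X' : Motives.SchemeOver ℂ} (Φ Φ' : (ι → ℝ) ≃L[ℝ] E)
    (φ : ComplexTorus Φ → Motives.ComplexPoints X) (hφ : IsAnalytification E X n φ)
    (φ' : ComplexTorus Φ' → Motives.ComplexPoints X') (hφ' : IsAnalytification E X' n φ')
    (e₀ e₀' : ComplexDeRhamIsoFamily E) (he₀ : e₀.IsNatural) (he₀' : e₀'.IsNatural)
    (M : Type) [TopologicalSpace M] [ChartedSpace E M] [IsManifold 𝓘(ℝ, E) ∞ M] [T2Space M]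
    [SigmaCompactSpace M] (k : ℕ) :
    HodgeModel.inducedIso B
        ({ model := E, carrier := ComplexTorus Φ, toComplexPoints := φ, isAnalytification := hφ,
           deRham := e₀, deRham_isNatural := he₀,
           isInternal_hodgePQ := Literature.Geometry.Kaehler.ComplexTorus.isInternal_hodgePQ Φ } :
          HodgeModel n X) hnm M k =
      HodgeModel.inducedIso B
        ({ model := E, carrier := ComplexTorus Φ', toComplexPoints := φ', isAnalytification := hφ',
           deRham := e₀', deRham_isNatural := he₀',
           isInternal_hodgePQ := Literature.Geometry.Kaehler.ComplexTorus.isInternal_hodgePQ Φ' } :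
          HodgeModel n X') hnm M k :=
  rfl

/-- **Transport of the rigidity scalar between two torus models over `(E, e₀)`.**  If the torus
Hodge model `⟨E, ComplexTorus Φ, φ, hφ, e₀, …⟩` of `X` satisfies `e₀ = r • inducedIso B _ hnm` in degree
`k` on its carrier, then so does the torus Hodge model `⟨E, ComplexTorus Φ′, φ′, hφ′, e₀, …⟩` of any
`X′` (same model `E`, same index type, same comparison family `e₀`): the carriers are diffeomorphic
(`complexTorus_exists_diffeomorph`), both families are natural, and the induced comparison is the
same map for both models (`inducedIso_torusModel_eq`).
[cite: BottTu1982Forms, §I.5] [cite: LangeBirkenhake1992, §1.1.2] -/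
theorem torusModel_deRham_eq_smul_inducedIso_transport (B : HodgeModel m Y) (hnm : n ≤ m)
    {e₀ : ComplexDeRhamIsoFamily E} (he₀ : e₀.IsNatural) (k : ℕ) {r : ℂ}
    {X : Motives.SchemeOver ℂ} (Φ : (ι → ℝ) ≃L[ℝ] E) (φ : ComplexTorus Φ → Motives.ComplexPoints X)
    (hφ : IsAnalytification E X n φ)
    (hr : ∀ y : complexDeRhamCohomology E (ComplexTorus Φ) k,
      e₀ (ComplexTorus Φ) k y =
        r • HodgeModel.inducedIso B
          ({ model := E, carrier := ComplexTorus Φ, toComplexPoints := φ, isAnalytification := hφ,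
             deRham := e₀, deRham_isNatural := he₀,
             isInternal_hodgePQ := Literature.Geometry.Kaehler.ComplexTorus.isInternal_hodgePQ Φ } :
            HodgeModel n X) hnm (ComplexTorus Φ) k y)
    {X' : Motives.SchemeOver ℂ} (Φ' : (ι → ℝ) ≃L[ℝ] E) (φ' : ComplexTorus Φ' → Motives.ComplexPoints X')
    (hφ' : IsAnalytification E X' n φ') :
    ∀ y' : complexDeRhamCohomology E (ComplexTorus Φ') k,
      e₀ (ComplexTorus Φ') k y' =
        r • HodgeModel.inducedIso B
          ({ model := E, carrier := ComplexTorus Φ', toComplexPoints := φ', isAnalytification := hφ',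
             deRham := e₀, deRham_isNatural := he₀,
             isInternal_hodgePQ := Literature.Geometry.Kaehler.ComplexTorus.isInternal_hodgePQ Φ' } :
            HodgeModel n X') hnm (ComplexTorus Φ') k y' := by
  obtain ⟨h, -, hh, -⟩ := complexTorus_exists_diffeomorph Φ Φ'
  intro y'
  rw [← inducedIso_torusModel_eq B hnm Φ Φ' φ hφ φ' hφ' e₀ e₀ he₀ he₀ (ComplexTorus Φ') k]
  exact HodgeModel.deRham_eq_smul_inducedIso_transport
    ({ model := E, carrier := ComplexTorus Φ, toComplexPoints := φ, isAnalytification := hφ,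
       deRham := e₀, deRham_isNatural := he₀,
       isInternal_hodgePQ := Literature.Geometry.Kaehler.ComplexTorus.isInternal_hodgePQ Φ } :
      HodgeModel n X) B hnm (M' := ComplexTorus Φ') h hh k hr y'

/-- **ONE non-zero rigidity scalar for all torus models over `(E, e₀)`** (the design constraint of the
N3-core assembler: the scalar is quantified BEFORE the fibre datum).  Fix a finite-dimensional complex
model space `E`, an index type `ι`, a natural comparison family `e₀` over `E`-manifolds, a Hodge model
`B` of a variety of dimension `m ≥ n`, a degree `k`, and ONE anchor: a smooth projective `X₀` of
dimension `n` analytified by a complex torus `E/Φ₀(ℤ^ι)`.  Then there is `r ≠ 0` such that for EVERY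
scheme `X` of dimension `n` analytified by a complex torus `E/Φ(ℤ^ι)` (via `φ`, `hφ`), the torus Hodge
model `⟨E, ComplexTorus Φ, φ, hφ, e₀, …⟩` has `e₀ = r • inducedIso B _ hnm` in degree `k` on its carrier.
The anchor supplies `r` (`HodgeModel.exists_ne_zero_deRham_eq_smul_inducedIso`), and
`torusModel_deRham_eq_smul_inducedIso_transport` moves it to every other torus.  Consumers combine it
fibrewise with the explicit-scalar comparison `HodgeModel.chernCharacter_pullback_eq_smul_map_of_deRham_eq_smul`.
[cite: BottTu1982Forms, §I.5] [cite: LangeBirkenhake1992, §1.1.2] [cite: VoisinHodgeI2002, §7.3.2] -/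
theorem exists_ne_zero_forall_torusModel_deRham_eq_smul_inducedIso
    {e₀ : ComplexDeRhamIsoFamily E} (he₀ : e₀.IsNatural) (B : HodgeModel m Y) (hnm : n ≤ m) (k : ℕ)
    {X₀ : Motives.SchemeOver ℂ} (hX₀ : Motives.IsSmoothProjective n X₀) (Φ₀ : (ι → ℝ) ≃L[ℝ] E)
    (φ₀ : ComplexTorus Φ₀ → Motives.ComplexPoints X₀) (hφ₀ : IsAnalytification E X₀ n φ₀) :
    ∃ r : ℂ, r ≠ 0 ∧ ∀ (X : Motives.SchemeOver ℂ) (Φ : (ι → ℝ) ≃L[ℝ] E)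
      (φ : ComplexTorus Φ → Motives.ComplexPoints X) (hφ : IsAnalytification E X n φ)
      (y : complexDeRhamCohomology E (ComplexTorus Φ) k),
      e₀ (ComplexTorus Φ) k y =
        r • HodgeModel.inducedIso B
          ({ model := E, carrier := ComplexTorus Φ, toComplexPoints := φ, isAnalytification := hφ,
             deRham := e₀, deRham_isNatural := he₀,
             isInternal_hodgePQ := Literature.Geometry.Kaehler.ComplexTorus.isInternal_hodgePQ Φ } :
            HodgeModel n X) hnm (ComplexTorus Φ) k y := by
  obtain ⟨r, hr0, hr⟩ := HodgeModel.exists_ne_zero_deRham_eq_smul_inducedIso hX₀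
    ({ model := E, carrier := ComplexTorus Φ₀, toComplexPoints := φ₀, isAnalytification := hφ₀,
       deRham := e₀, deRham_isNatural := he₀,
       isInternal_hodgePQ := Literature.Geometry.Kaehler.ComplexTorus.isInternal_hodgePQ Φ₀ } :
      HodgeModel n X₀) B hnm k
  exact ⟨r, hr0, fun X Φ φ hφ ↦
    torusModel_deRham_eq_smul_inducedIso_transport B hnm he₀ k Φ₀ φ₀ hφ₀ hr Φ φ hφ⟩

end TorusModels

end Literature.AlgebraicGeometry.HodgeTheory

end
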